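import Literature.NumberTheory.Sieve.SmoothCompletionOfSums
import HarnessLib

/-!
# Completion of sums with smooth weights: the case of a short modulus (all frequencies in the tail)

Topic `Literature/NumberTheory/Sieve`, grouping namespace `Polymath8a`; a companion of
`SmoothCompletionOfSums` (D. H. J. Polymath, *New equidistribution estimates of Zhang type*, Algebra &
Number Theory 8 (2014), Lemma 4.9).  Everything here is PROVED; no definition, no named fact.

`Polymath8a.completion_truncated` bounds `|∑_k ψ_M(b+dk) g(b+dk) − (M'/Q) ∑_j g(b+dj)|` by the dual sum
over `0 < |h| ≤ H` plus a tail `≪ H^{1−n}`, for a truncation point `H ≥ 1`.  When the modulus `Q = dq`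
is shorter than the length `M` of the weight (`Q ≤ M^{1−ε}`, i.e. the natural truncation point
`H = QM^{−1+ε}` is `< 1`), the right statement has NO dual terms at all: every non-zero frequency is in
the range of rapid decay of `ψ̂`.  This is the form used at the "diagonal" moduli in dispersion
arguments (e.g. S. Drappeau, Proc. LMS 114 (2017), §5.3, where `H = W^{1+ε}/M < 1` for `W < M^{1−ε}`):

* `Polymath8a.completion_decay` — for `n ≥ 2`,
  `|∑_k ψ((b+dk−x₀)/M) g(b+dk) − (M'/Q) ∑_{j<q} g(b+dj)| ≤ (∑_{j<q} |g(b+dj)|) · 4 (∫|ψ^{(n)}|) (Q/(2πM))^n (M/Q)`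
  (from `Polymath8a.completion_identity`, the decay `|ψ̂(Mh/Q)| ≤ (∫|ψ^{(n)}|)(Q/(2πM))^n |h|^{−n}` and
  `∑_{h ≠ 0} |h|^{−n} ≤ 4`).

## References

* D. H. J. Polymath, Algebra & Number Theory 8 (2014) 2067–2199 = arXiv:1402.0811, Lemma 4.9 and its
  proof. [cite: Polymath8a2014, Lemma 4.9]
-/

noncomputable section

open Real MeasureTheory Filter Complex Finset
open scoped FourierTransform Topology ContDiff

namespace Literature.NumberTheory.Sieve

namespace Polymath8a

open Literature.NumberTheory.Sieve.FriedlanderIwaniecPrimes (norm_fourier_div_le)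

variable {ψ : ℝ → ℂ} {M : ℝ}

/-- **Completion with all non-zero frequencies in the tail**: for a smooth compactly supported `ψ`,
`M > 0`, `d, q ≥ 1`, a `q`-periodic `g` and `n ≥ 2`,
`|∑_k ψ((b+dk−x₀)/M) g(b+dk) − (M'/(dq)) ∑_{j<q} g(b+dj)| ≤ (∑_{j<q}|g(b+dj)|) · 4(∫|ψ^{(n)}|)(dq/(2πM))^n (M/(dq))`,
`M' = ∑_m ψ((m − x₀)/M)` — useful when `dq < M`. [cite: Polymath8a2014, Lemma 4.9 (proof)] -/
theorem completion_decay (hψ : ContDiff ℝ ∞ ψ) (hψc : HasCompactSupport ψ) (hM : 0 < M)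
    (x₀ : ℝ) {d q : ℕ} (hd : 0 < d) (hq : 0 < q) (b : ℤ) {g : ℤ → ℂ}
    (hg : ∀ m n : ℤ, g (m + q * n) = g m) {n : ℕ} (hn : 2 ≤ n) :
    ‖∑' k : ℤ, ψ ((b + d * k - x₀) / M) * g (b + d * k) -
        (∑' m : ℤ, ψ ((m - x₀) / M)) / ((d * q : ℕ) : ℂ) * ∑ j ∈ Finset.range q, g (b + d * j)‖ ≤
      (∑ j ∈ Finset.range q, ‖g (b + d * j)‖) * (4 * (∫ t, ‖iteratedDeriv n ψ t‖) *
        (((d * q : ℕ) : ℝ) / (2 * π * M)) ^ n * (M / (d * q : ℕ))) := by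
  have hdq : 0 < d * q := Nat.mul_pos hd hq
  have hQ : (0 : ℝ) < (d * q : ℕ) := by exact_mod_cast hdq
  set Qr : ℝ := ((d * q : ℕ) : ℝ) with hQr
  set D : ℝ := Qr / M with hD
  have hD0 : 0 < D := div_pos hQ hM
  set In : ℝ := ∫ t, ‖iteratedDeriv n ψ t‖ with hIn
  have hInn : 0 ≤ In := integral_nonneg fun _ => norm_nonneg _
  set G : ℝ := ∑ j ∈ Finset.range q, ‖g (b + d * j)‖ with hG
  have hG0 : 0 ≤ G := Finset.sum_nonneg fun _ _ => norm_nonneg _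
  set T : ℤ → ℂ := fun h => ∑ j ∈ Finset.range q, g (b + d * j) *
    (𝐞 (((b + d * j : ℤ) : ℝ) * h / (d * q : ℕ)) : ℂ) with hT
  have hTle : ∀ h : ℤ, ‖T h‖ ≤ G := fun h => norm_twistedSum_le d q b g h
  rw [completion_identity hψ hψc hM x₀ hd hq b hg, add_sub_cancel_left, norm_mul, norm_div,
    Complex.norm_real, Complex.norm_natCast, Real.norm_eq_abs, abs_of_pos hM]
  -- the decay of `ψ̂` at the non-zero frequencies
  set F : ℤ → ℝ := fun h => |(h : ℝ)| ^ (-(n : ℝ)) with hF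
  have hF0 : ∀ h, 0 ≤ F h := fun h => Real.rpow_nonneg (abs_nonneg _) _
  have hF00 : F 0 = 0 := by
    simp only [hF, Int.cast_zero, abs_zero]
    have h2 : (2 : ℝ) ≤ n := by exact_mod_cast hn
    exact Real.zero_rpow (by linarith)
  have hFpos : ∀ ν : ℕ, 1 ≤ ν → F ν = (((ν : ℝ)) ^ n)⁻¹ ∧ F (-(ν : ℤ)) = (((ν : ℝ)) ^ n)⁻¹ := by
    intro ν hν
    have hν0 : (0 : ℝ) < ν := by exact_mod_cast hν
    simp only [hF, Int.cast_neg, Int.cast_natCast, abs_neg, abs_of_pos hν0]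
    rw [Real.rpow_neg hν0.le, Real.rpow_natCast]
    exact ⟨rfl, rfl⟩
  have hFsum : ∀ u : Finset ℤ, ∑ h ∈ u, F h ≤ 4 := by
    intro u
    obtain ⟨N, hN⟩ := exists_subset_Icc_neg u
    refine (Finset.sum_le_sum_of_subset_of_nonneg hN fun h _ _ => hF0 h).trans ?_
    rw [sum_Icc_neg_eq _ N, hF00, zero_add]
    have h2 := sum_Icc_inv_pow_le_two hn N
    calc ∑ ν ∈ Finset.Icc 1 N, (F ν + F (-(ν : ℤ)))
        = ∑ ν ∈ Finset.Icc 1 N, ((((ν : ℝ)) ^ n)⁻¹ + (((ν : ℝ)) ^ n)⁻¹) := by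
          refine Finset.sum_congr rfl fun ν hν => ?_
          have h := hFpos ν (Finset.mem_Icc.1 hν).1
          rw [h.1, h.2]
      _ = 2 * ∑ ν ∈ Finset.Icc 1 N, (((ν : ℝ)) ^ n)⁻¹ := by
          rw [Finset.mul_sum]; refine Finset.sum_congr rfl fun ν _ => by ring
      _ ≤ 2 * 2 := by linarith
      _ = 4 := by norm_num
  -- termwise bound
  have hpt : ∀ h : ℤ, ‖(if ((d * q : ℕ) : ℤ) ∣ h then (0 : ℂ) else
      (𝐞 (-(x₀ * h / (d * q : ℕ))) : ℂ) * 𝓕 ψ (M * h / (d * q : ℕ)) * T h)‖ ≤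
      In * (D / (2 * π)) ^ n * G * F h := by
    intro h
    by_cases hdvd : ((d * q : ℕ) : ℤ) ∣ h
    · rw [if_pos hdvd, norm_zero]
      have := hF0 h; positivity
    · have hh0 : h ≠ 0 := by rintro rfl; exact hdvd (dvd_zero _)
      have hhabs : 0 < |(h : ℝ)| := abs_pos.2 (by exact_mod_cast hh0)
      rw [if_neg hdvd, norm_mul, norm_mul, Circle.norm_coe, one_mul]
      have e1 : M * (h : ℝ) / ((d * q : ℕ) : ℝ) = (h : ℝ) / D := by rw [hD, hQr]; field_simp
      rw [e1]
      have hψh := norm_fourier_div_le hψ hψc n hD0 (k := (h : ℝ)) hhabs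
      have hFh : F h = (|(h : ℝ)| ^ n)⁻¹ := by
        rw [hF]; dsimp only; rw [Real.rpow_neg (abs_nonneg _), Real.rpow_natCast]
      rw [hFh]
      calc ‖𝓕 ψ ((h : ℝ) / D)‖ * ‖T h‖ ≤ (In * (D / (2 * π)) ^ n * (|(h : ℝ)| ^ n)⁻¹) * G :=
            mul_le_mul hψh (hTle h) (norm_nonneg _) (by positivity)
        _ = In * (D / (2 * π)) ^ n * G * (|(h : ℝ)| ^ n)⁻¹ := by ring
  -- summing
  have hbound : ‖∑' h : ℤ, (if ((d * q : ℕ) : ℤ) ∣ h then (0 : ℂ) else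
      (𝐞 (-(x₀ * h / (d * q : ℕ))) : ℂ) * 𝓕 ψ (M * h / (d * q : ℕ)) * T h)‖ ≤
      In * (D / (2 * π)) ^ n * G * 4 := by
    have hFs : Summable F := by
      have := Real.summable_abs_int_rpow (b := (n : ℝ)) (by exact_mod_cast (by omega : 1 < n))
      simpa [hF] using this
    have hsn : Summable fun h : ℤ => ‖(if ((d * q : ℕ) : ℤ) ∣ h then (0 : ℂ) else
        (𝐞 (-(x₀ * h / (d * q : ℕ))) : ℂ) * 𝓕 ψ (M * h / (d * q : ℕ)) * T h)‖ :=
      Summable.of_nonneg_of_le (fun _ => norm_nonneg _) hpt (hFs.mul_left _)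
    refine (norm_tsum_le_tsum_norm hsn).trans ?_
    refine (hsn.tsum_le_tsum hpt (hFs.mul_left _)).trans ?_
    rw [tsum_mul_left]
    refine mul_le_mul_of_nonneg_left (Real.tsum_le_of_sum_le hF0 hFsum) (by positivity)
  calc M / ((d * q : ℕ) : ℝ) * ‖∑' h : ℤ, (if ((d * q : ℕ) : ℤ) ∣ h then (0 : ℂ) else
        (𝐞 (-(x₀ * h / (d * q : ℕ))) : ℂ) * 𝓕 ψ (M * h / (d * q : ℕ)) * T h)‖
      ≤ M / ((d * q : ℕ) : ℝ) * (In * (D / (2 * π)) ^ n * G * 4) :=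
        mul_le_mul_of_nonneg_left hbound (by positivity)
    _ = G * (4 * In * (Qr / (2 * π * M)) ^ n * (M / (d * q : ℕ))) := by
        rw [hD, hQr]
        rw [show ((d * q : ℕ) : ℝ) / M / (2 * π) = ((d * q : ℕ) : ℝ) / (2 * π * M) by
          field_simp]
        ring

end Polymath8a

end Literature.NumberTheory.Sieve

end
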